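import Summits.SmoothPoincare4.SmoothPoincare4.Theorems.CylinderEntropySliceIsolationStubCertHighAux
import Literature.Geometry.Riemannian.SphericalZonalHamiltonHarnack
import Literature.Geometry.Riemannian.SphericalCylinderEntropySmallScales
import Mathlib
import HarnessLib

/-!
# High-scale certificate for the conformal kernel domination (stub `stub_certHigh`, `100 ≤ T ≤ 4·10⁴`)

Helper for the line `conformal-kernel-domination` of the crux
`Summit.SmoothPoincare4.SmoothPoincare4.Theses.CylinderEntropy.SliceIsolation` (crux item stmt-SmoothPoincare4-7632).
In the normalised variables `T = t/‖y‖² > 0`, `u = z₅ − log ‖y‖`, `s = ⟨z', ŷ⟩ ∈ [−1, 1]` the Jacobian-weighted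
pulled-back Euclidean Gaussian kernel times `V = 8π²/3` is
`pulled(T,u,s) = (8π²/3)((4πT)²)⁻¹ e^{4u} exp(−(e^{2u} − 2eᵘ s + 1)/(4T))`.  We prove that for `100 ≤ T ≤ 4·10⁴`
(only `T ≥ 98` is used) the flat atom plus ONE on-axis cylinder ("zonal") kernel dominate it on `ℝ × [−1, 1]` with
total mass `≤ 147/100`: with `b := √(2/T) ≤ 1/7`, `Λ₄ := 32/(3e²)`,
`σ := log(4/b) = ½ log(8T)`, `τ := log 2`, `w := Λ₄ (161/50) b`, `c := Λ₄ (509/500 − (161/50) b)`,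
so that `w + c = (509/500) Λ₄ ≤ 147/100` (`e ≥ 2.7182818283`).

Proof.  Put `r = eᵘ`, `x = r b/4`, `ρ = x²`; then `(8π²/3)((4πT)²)⁻¹ e^{4u} = (32/3) ρ²`,
`−(r² − 2rs + 1)/(4T) = −2ρ + bxs − b²/8` and `u − σ = log x`, so the claim is `Λ₄`-times
`(★) ρ² e^{2−2ρ} e^{bxs} ≤ (509/500 − (161/50) b) + (161/50) b · E · 𝔥(log 2, s)`, `E = exp(−(log ρ)²/(16 log 2))`
(the factor `e^{−b²/8} ≤ 1` is dropped).
* FAR `ρ ≥ 3` (`certHigh_far`): `bxs ≤ x/7 ≤ 2ρ/49 + 1/8`, `e^{y} ≥ 1 + y + y²/2 + y³/6` at `y = 96ρ/49 − 17/8` and a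
  cubic with positive coefficients in `ρ − 3` give `ρ² e^{2−2ρ} e^{bxs} ≤ 279/500 ≤ 509/500 − (161/50) b`; `𝔥 ≥ 0`.
* NEAR `ρ ≤ 3`: `|bxs| ≤ 1/4`, so `e^{bxs} ≤ 1 + bxs + (5/9)(bxs)²` (`Real.exp_bound`); the zonal kernel at the dyadic
  scale `log 2` has the quadratic minorant `Q(s) = 51017/51200 + (5/16)s + (35/2048)s²` (`certHigh_zonal_lower`: five
  terms of its Gegenbauer series, whose weights are `(1/2)^{k(k+3)}(2k+3)/3`, the cubic/quartic terms and the geometric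
  tail `≤ 1/28672` absorbed into `−1/6400`); the resulting sufficient inequality
  `F(b) := (509/500 − (161/50)b) + (161/50) b E Q(s) − G (1 + bxs + (5/9) b²ρ s²) ≥ 0` (`G = ρ² e^{2−2ρ}`) is a CONCAVE
  quadratic in `b`, nonnegative at `b = 0` (`G ≤ 1`) and at `b = 1/7`, where it is a quadratic in `s` with
  `a₂ ≤ a₀`, `0 ≤ a₀` and nonnegative endpoint values (`certHigh_quad`) by the three conditions of the aux file
  `CylinderEntropySliceIsolationStubCertHighAux.lean` (`helper_certHighConds`, thirteen polynomial cells).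
Numerically the scheme has `≥ 0.8 %` slack everywhere; the true optimum of flat + one atom is `≈ Λ₄ + 0.008`.
-/

noncomputable section

-- the registered namespace `Summit.SmoothPoincare4.SmoothPoincare4.Theorems…` repeats a component
set_option linter.dupNamespace false

namespace Summit.SmoothPoincare4.SmoothPoincare4.Theorems.CylinderEntropySliceIsolation

open Literature.Geometry.Riemannian Literature.Geometry.Riemannian.SphericalCylinderEntropy
open Literature.Geometry.Riemannian.SphericalZonalKernelSeries (zonal_nonneg)

/-! ### Elementary tools -/

/-- `e^y ≤ 1 + y + (5/9) y²` for `|y| ≤ 1/4`. [folklore] -/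
theorem certHigh_exp_quad {y : ℝ} (hy : |y| ≤ 1 / 4) :
    Real.exp y ≤ 1 + y + 5 / 9 * y ^ 2 := by
  have hy1 : |y| ≤ 1 := hy.trans (by norm_num)
  have h := Real.exp_bound hy1 (n := 3) (by norm_num)
  simp only [Finset.sum_range_succ, Finset.sum_range_zero, Nat.factorial] at h
  norm_num at h
  have h2 := (abs_le.1 h).2
  have hy3 : |y| ^ 3 ≤ 1 / 4 * y ^ 2 := by
    have h3 : |y| ^ 3 = y ^ 2 * |y| := by rw [pow_succ, sq_abs]
    rw [h3]
    nlinarith [sq_nonneg y, abs_nonneg y]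
  nlinarith [h2, hy3]

/-- A quadratic `a₀ + a₁ s + a₂ s²` with `0 ≤ a₀`, `a₂ ≤ a₀` and nonnegative values at `s = ±1` is
nonnegative on `[-1, 1]`. [folklore] -/
theorem certHigh_quad {a₀ a₁ a₂ s : ℝ} (hs1 : -1 ≤ s) (hs2 : s ≤ 1) (h0 : 0 ≤ a₀) (h2 : a₂ ≤ a₀)
    (hp : 0 ≤ a₀ + a₁ + a₂) (hm : 0 ≤ a₀ - a₁ + a₂) : 0 ≤ a₀ + a₁ * s + a₂ * s ^ 2 := by
  rcases le_total 0 s with hs | hs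
  · have key : a₀ + a₁ * s + a₂ * s ^ 2 = (1 - s) * (a₀ - a₂ * s) + s * (a₀ + a₁ + a₂) := by ring
    rw [key]
    have h3 : 0 ≤ a₀ - a₂ * s := by
      rcases le_total 0 a₂ with ha | ha
      · nlinarith [mul_le_mul_of_nonneg_left hs2 ha]
      · nlinarith [mul_nonneg_of_nonpos_of_nonpos ha (le_refl 0), mul_le_mul_of_nonpos_left hs ha]
    nlinarith [mul_nonneg (sub_nonneg.2 hs2) h3, mul_nonneg hs hp]
  · have key : a₀ + a₁ * s + a₂ * s ^ 2 = (1 + s) * (a₀ + a₂ * s) + (-s) * (a₀ - a₁ + a₂) := by ring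
    rw [key]
    have h3 : 0 ≤ a₀ + a₂ * s := by
      rcases le_total 0 a₂ with ha | ha
      · nlinarith [mul_le_mul_of_nonneg_left hs1 ha]
      · nlinarith [mul_nonneg_of_nonpos_of_nonpos ha hs]
    nlinarith [mul_nonneg (show (0 : ℝ) ≤ 1 + s by linarith) h3, mul_nonneg (neg_nonneg.2 hs) hm]

/-- `ρ² e^{2 − 2ρ} ≤ 1` for `ρ ≥ 0` (from `ρ ≤ e^{ρ−1}`). [folklore] -/
theorem certHigh_G_le_one {ρ : ℝ} (hρ : 0 ≤ ρ) : ρ ^ 2 * Real.exp (2 - 2 * ρ) ≤ 1 := by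
  have h1 : ρ ≤ Real.exp (ρ - 1) := by linarith [Real.add_one_le_exp (ρ - 1)]
  have h3 : Real.exp (1 - ρ) * Real.exp (ρ - 1) = 1 := by
    rw [← Real.exp_add]; norm_num
  have h2 : ρ * Real.exp (1 - ρ) ≤ 1 := by
    nlinarith [mul_le_mul_of_nonneg_left h1 (Real.exp_pos (1 - ρ)).le]
  have h4 : ρ ^ 2 * Real.exp (2 - 2 * ρ) = (ρ * Real.exp (1 - ρ)) ^ 2 := by
    rw [mul_pow, ← Real.exp_nat_mul]
    congr 1
    push_cast
    ring_nf
  rw [h4]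
  have h5 : 0 ≤ ρ * Real.exp (1 - ρ) := by positivity
  nlinarith

/-- FAR region `ρ ≥ 3`: the flat atom alone dominates, `ρ² e^{2−2ρ} e^{bx s} ≤ 279/500` for
`x² = ρ`, `0 ≤ b ≤ 1/7`, `|s| ≤ 1`. [folklore] -/
theorem certHigh_far {ρ x b s : ℝ} (hρ : 3 ≤ ρ) (hx : 0 ≤ x) (hxρ : x ^ 2 = ρ) (hb0 : 0 ≤ b)
    (hb1 : b ≤ 1 / 7) (hs2 : s ≤ 1) :
    ρ ^ 2 * Real.exp (2 - 2 * ρ) * Real.exp (b * x * s) ≤ 279 / 500 := by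
  have h1 : b * x * s ≤ x / 7 := by
    have : b * x * s ≤ b * x := by nlinarith [mul_nonneg hb0 hx]
    nlinarith [mul_le_mul_of_nonneg_right hb1 hx]
  have h2 : x / 7 ≤ 2 * ρ / 49 + 1 / 8 := by nlinarith [sq_nonneg (x - 7 / 4)]
  have h3 : Real.exp (2 - 2 * ρ) * Real.exp (b * x * s) ≤ Real.exp (17 / 8 - 96 / 49 * ρ) := by
    rw [← Real.exp_add]; exact Real.exp_le_exp.2 (by linarith)
  have hy0 : 0 ≤ 96 / 49 * ρ - 17 / 8 := by linarith
  have h4 : 1 + (96 / 49 * ρ - 17 / 8) + (96 / 49 * ρ - 17 / 8) ^ 2 / 2 +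
      (96 / 49 * ρ - 17 / 8) ^ 3 / 6 ≤ Real.exp (96 / 49 * ρ - 17 / 8) := by
    have h := Real.sum_le_exp_of_nonneg hy0 4
    simp only [Finset.sum_range_succ, Finset.sum_range_zero, Nat.factorial] at h
    norm_num at h
    linarith [h]
  have h5 : Real.exp (17 / 8 - 96 / 49 * ρ) * Real.exp (96 / 49 * ρ - 17 / 8) = 1 := by
    rw [← Real.exp_add]; norm_num
  have hpoly : ρ ^ 2 ≤ 279 / 500 * (1 + (96 / 49 * ρ - 17 / 8) + (96 / 49 * ρ - 17 / 8) ^ 2 / 2 +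
      (96 / 49 * ρ - 17 / 8) ^ 3 / 6) := by
    have ht : 0 ≤ ρ - 3 := by linarith
    nlinarith [pow_nonneg ht 2, pow_nonneg ht 3]
  have h6 : ρ ^ 2 * Real.exp (17 / 8 - 96 / 49 * ρ) ≤ 279 / 500 := by
    have h7 : ρ ^ 2 ≤ 279 / 500 * Real.exp (96 / 49 * ρ - 17 / 8) := by nlinarith [h4, hpoly]
    nlinarith [mul_le_mul_of_nonneg_right h7 (Real.exp_pos (17 / 8 - 96 / 49 * ρ)).le, h5]
  calc ρ ^ 2 * Real.exp (2 - 2 * ρ) * Real.exp (b * x * s)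
      = ρ ^ 2 * (Real.exp (2 - 2 * ρ) * Real.exp (b * x * s)) := by ring
    _ ≤ ρ ^ 2 * Real.exp (17 / 8 - 96 / 49 * ρ) := mul_le_mul_of_nonneg_left h3 (sq_nonneg ρ)
    _ ≤ 279 / 500 := h6

/-! ### The quadratic minorant of the zonal kernel at `τ = log 2` -/

/-- The heat weights at `τ = log 2` are dyadic rationals: `wt k (log 2) = (1/2)^{k(k+3)} (2k+3)/3`.
[folklore] -/
theorem certHigh_wt (k : ℕ) :
    wt k (Real.log 2) = (1 / 2 : ℝ) ^ (k * (k + 3)) * ((2 * (k : ℝ) + 3) / 3) := by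
  have h : -((k : ℝ) * ((k : ℝ) + 3)) * Real.log 2 = ((k * (k + 3) : ℕ) : ℝ) * Real.log (1 / 2) := by
    rw [one_div, Real.log_inv]; push_cast; ring
  rw [wt, h, Real.exp_nat_mul, Real.exp_log (by norm_num)]

/-- Geometric tail of the zonal series at `τ = log 2` after five terms:
`|∑_{k ≥ 5} wt k (log 2) C_k(s)| ≤ (1/8)⁵/(1 − 1/8)` for `|s| ≤ 1` (term bound
`e^{-k(k+3) log 2} 32^k ≤ (32/256)^k` for `k ≥ 5`). [folklore] -/
-- adapted from `SphericalZonalKernelSeries.abs_zonal_sub_partialSum_le_geometric` (Literature, same tree)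
theorem certHigh_zonal_tail {s : ℝ} (hs : |s| ≤ 1) :
    |∑' i : ℕ, wt (i + 5) (Real.log 2) * gegen (i + 5) s| ≤ (1 / 8 : ℝ) ^ 5 / (1 - 1 / 8) := by
  have hL : 0 < Real.log 2 := Real.log_pos one_lt_two
  have hgeom := (hasSum_geometric_of_lt_one (by norm_num : (0 : ℝ) ≤ 1 / 8)
    (by norm_num : (1 / 8 : ℝ) < 1)).mul_left ((1 / 8 : ℝ) ^ 5)
  have h := tsum_of_norm_bounded
    (f := fun i : ℕ => wt (i + 5) (Real.log 2) * gegen (i + 5) s) hgeom fun i => by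
    rw [Real.norm_eq_abs]
    refine (abs_term_le_majorant _ _ hs).trans ?_
    have hi : (0 : ℝ) ≤ (i : ℝ) := i.cast_nonneg
    have h1 : Real.exp (-(((i + 5 : ℕ) : ℝ) * (((i + 5 : ℕ) : ℝ) + 3)) * Real.log 2) ≤
        Real.exp (((i + 5 : ℕ) : ℝ) * Real.log (1 / 256)) := by
      refine Real.exp_le_exp.2 ?_
      rw [one_div, Real.log_inv, show (256 : ℝ) = 2 ^ 8 by norm_num, Real.log_pow]
      push_cast
      nlinarith [mul_nonneg hi hL.le, mul_nonneg (mul_nonneg hi hi) hL.le]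
    rw [Real.exp_nat_mul, Real.exp_log (by norm_num)] at h1
    calc Real.exp (-(((i + 5 : ℕ) : ℝ) * (((i + 5 : ℕ) : ℝ) + 3)) * Real.log 2) * 32 ^ (i + 5)
        ≤ (1 / 256 : ℝ) ^ (i + 5) * 32 ^ (i + 5) :=
          mul_le_mul_of_nonneg_right h1 (by positivity)
      _ = (1 / 8 : ℝ) ^ 5 * (1 / 8) ^ i := by rw [← mul_pow, ← pow_add]; norm_num; ring
  rw [Real.norm_eq_abs, ← div_eq_mul_inv] at h
  exact h

/-- **Quadratic minorant of the zonal kernel at `τ = log 2`**: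
`Q(s) := 51017/51200 + (5/16) s + (35/2048) s² ≤ 𝔥(log 2, s)` on `[-1, 1]` (five dyadic terms of
the series, the cubic and quartic ones and the geometric tail `≤ 1/28672` absorbed into the
constant `1/6400`). [folklore] -/
theorem certHigh_zonal_lower {s : ℝ} (hs1 : -1 ≤ s) (hs2 : s ≤ 1) :
    51017 / 51200 + 5 / 16 * s + 35 / 2048 * s ^ 2 ≤ zonal (Real.log 2) s := by
  have hs : |s| ≤ 1 := abs_le.2 ⟨hs1, hs2⟩
  have hL : 0 < Real.log 2 := Real.log_pos one_lt_two
  have hsplit := (summable_term_of_pos hL hs).sum_add_tsum_nat_add 5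
  have htail := (abs_le.1 (certHigh_zonal_tail hs)).1
  rw [zonal, ← hsplit]
  generalize ∑' i : ℕ, wt (i + 5) (Real.log 2) * gegen (i + 5) s = Tl at htail ⊢
  simp only [Finset.sum_range_succ, Finset.sum_range_zero, certHigh_wt, gegen,
    Finset.prod_range_succ, Finset.prod_range_zero, Nat.factorial]
  norm_num
  have h3 : 0 ≤ (s + 1) * (7 * s ^ 2 - 7 * s + 4) :=
    mul_nonneg (by linarith) (by nlinarith [sq_nonneg (s - 1 / 2)])
  have h4 : s ^ 2 ≤ 1 := by nlinarith
  nlinarith [h3, h4, sq_nonneg (s ^ 2), htail]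

/-! ### The certificate -/

/-- **The normalised certificate.** For `0 ≤ b ≤ 1/7`, `x > 0`, `|s| ≤ 1`:
`x⁴ e^{2−2x²} e^{b x s} ≤ (509/500 − (161/50) b) + (161/50) b · exp(−(log x²)²/(16 log 2)) · 𝔥(log 2, s)`
(quadratic upper bound of `e^{bxs}` in `s`, quadratic minorant of `𝔥(log 2, ·)`, the three
conditions of `certHigh_conds` at `b = 1/7`, concavity in `b`; the far region `x² ≥ 3` by
`certHigh_far`). [folklore] -/
theorem certHigh_core {b x s : ℝ} (hb0 : 0 ≤ b) (hb1 : b ≤ 1 / 7) (hx : 0 < x) (hs1 : -1 ≤ s)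
    (hs2 : s ≤ 1) :
    (x ^ 2) ^ 2 * Real.exp (2 - 2 * x ^ 2) * Real.exp (b * x * s) ≤
      (509 / 500 - 161 / 50 * b) + 161 / 50 * b *
        (Real.exp (-Real.log (x ^ 2) ^ 2 / (16 * Real.log 2)) * zonal (Real.log 2) s) := by
  set ρ := x ^ 2 with hρ
  have hρ0 : 0 < ρ := by positivity
  set G := ρ ^ 2 * Real.exp (2 - 2 * ρ) with hG
  set E := Real.exp (-Real.log ρ ^ 2 / (16 * Real.log 2)) with hE
  have hG0 : 0 ≤ G := by positivity
  have hE0 : 0 ≤ E := (Real.exp_pos _).le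
  have hZ0 : 0 ≤ zonal (Real.log 2) s := zonal_nonneg (Real.log_pos one_lt_two) s ⟨hs1, hs2⟩
  have hbEZ : 0 ≤ 161 / 50 * b * (E * zonal (Real.log 2) s) := by positivity
  rcases le_or_gt ρ 3 with hρ3 | hρ3
  · obtain ⟨hCp, hCm, hC0⟩ := helper_certHighConds ρ x hρ0 hρ3 hx.le hρ.symm
    have hx74 : x ≤ 7 / 4 := by nlinarith
    have hbx : b * x ≤ 1 / 4 := by nlinarith [mul_le_mul hb1 hx74 hx.le (by norm_num : (0 : ℝ) ≤ 1 / 7)]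
    have hbx0 : 0 ≤ b * x := mul_nonneg hb0 hx.le
    have habs : |b * x * s| ≤ 1 / 4 := by
      rw [abs_le]; constructor <;> nlinarith
    have hexp := certHigh_exp_quad habs
    have hZ := certHigh_zonal_lower hs1 hs2
    have hG1 : G ≤ 1 := certHigh_G_le_one hρ0.le
    -- the certificate at `b = 1/7`, all `s ∈ [-1, 1]`
    have hF1 : 0 ≤ 279 / 500 + 23 / 50 * E * (51017 / 51200 + 5 / 16 * s + 35 / 2048 * s ^ 2) -
        G * (1 + x / 7 * s + 5 / 441 * ρ * s ^ 2) := by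
      have hq := certHigh_quad (a₀ := 279 / 500 + 23 / 50 * E * (51017 / 51200) - G)
        (a₁ := 23 / 50 * E * (5 / 16) - G * (x / 7)) (a₂ := 23 / 50 * E * (35 / 2048) - G * (5 / 441 * ρ))
        hs1 hs2 (by linarith) (by nlinarith [mul_nonneg hG0 hρ0.le]) (by linarith) (by linarith)
      linarith
    -- concavity in `b`: interpolate between `b = 0` (where `G ≤ 1 ≤ 509/500`) and `b = 1/7`
    have hF : 0 ≤ (509 / 500 - 161 / 50 * b) +
        161 / 50 * b * E * (51017 / 51200 + 5 / 16 * s + 35 / 2048 * s ^ 2) -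
        G * (1 + b * x * s + 5 / 9 * (b ^ 2 * ρ * s ^ 2)) := by
      have h1 : 0 ≤ (1 - 7 * b) * (509 / 500 - G) := mul_nonneg (by linarith) (by linarith)
      have h2 : 0 ≤ 7 * b * (279 / 500 + 23 / 50 * E * (51017 / 51200 + 5 / 16 * s + 35 / 2048 * s ^ 2) -
          G * (1 + x / 7 * s + 5 / 441 * ρ * s ^ 2)) := mul_nonneg (by linarith) hF1
      have h3 : 0 ≤ G * (5 / 9) * ρ * s ^ 2 * (b * (1 / 7 - b)) :=
        mul_nonneg (by positivity) (mul_nonneg hb0 (by linarith))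
      linarith
    calc G * Real.exp (b * x * s) ≤ G * (1 + b * x * s + 5 / 9 * (b * x * s) ^ 2) :=
          mul_le_mul_of_nonneg_left hexp hG0
      _ = G * (1 + b * x * s + 5 / 9 * (b ^ 2 * ρ * s ^ 2)) := by rw [hρ]; ring
      _ ≤ (509 / 500 - 161 / 50 * b) +
          161 / 50 * b * E * (51017 / 51200 + 5 / 16 * s + 35 / 2048 * s ^ 2) := by linarith
      _ ≤ (509 / 500 - 161 / 50 * b) + 161 / 50 * b * (E * zonal (Real.log 2) s) := by
          have := mul_le_mul_of_nonneg_left hZ (show 0 ≤ 161 / 50 * b * E by positivity)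
          linarith
  · have hfar := certHigh_far hρ3.le hx.le hρ.symm hb0 hb1 hs2
    linarith

/-- **High-scale certificate** (`100 ≤ T ≤ 4·10⁴`, the flat atom plus ONE on-axis cylinder kernel
of scale `τ = log 2` centred at the peak height `σ = ½ log(8T)`): in the normalised variables
the Jacobian-weighted pulled-back Euclidean Gaussian kernel times `V = 8π²/3` is dominated on
`ℝ × [−1, 1]` by `w · 𝔥(τ, s) e^{−(u−σ)²/4τ} + c` with `w = Λ₄ (161/50) b`,
`c = Λ₄ (509/500 − (161/50) b)`, `b = √(2/T)`, `Λ₄ = 32/(3e²)`, so that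
`w + c = (509/500) Λ₄ ≤ 147/100`.  Registered stub `stub_certHigh` of the line
`conformal-kernel-domination`. [folklore] -/
theorem stub_certHigh :
    ∀ T : ℝ, 100 ≤ T → T ≤ 40000 → ∃ σ τ w c : ℝ, 0 < τ ∧ 0 ≤ w ∧ 0 ≤ c ∧ w + c ≤ 147 / 100 ∧
      ∀ u s : ℝ, -1 ≤ s → s ≤ 1 →
        (8 * Real.pi ^ 2 / 3) * ((4 * Real.pi * T) ^ 2)⁻¹ * Real.exp (4 * u) *
            Real.exp (-(Real.exp (2 * u) - 2 * Real.exp u * s + 1) / (4 * T)) ≤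
          w * (zonal τ s * Real.exp (-(u - σ) ^ 2 / (4 * τ))) + c := by
  intro T hT _
  have hT0 : 0 < T := by linarith
  set b : ℝ := Real.sqrt (2 / T) with hb
  have hb0 : 0 < b := Real.sqrt_pos.2 (by positivity)
  have hb2 : b ^ 2 = 2 / T := Real.sq_sqrt (by positivity)
  have hb1 : b ≤ 1 / 7 := by
    rw [hb, Real.sqrt_le_left (by norm_num), div_le_iff₀ hT0]
    nlinarith
  set Λ : ℝ := 32 / (3 * Real.exp 1 ^ 2) with hΛ
  have hΛ0 : 0 < Λ := by positivity
  refine ⟨-Real.log (b / 4), Real.log 2, Λ * (161 / 50 * b), Λ * (509 / 500 - 161 / 50 * b),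
    Real.log_pos one_lt_two, by positivity, mul_nonneg hΛ0.le (by linarith), ?_, ?_⟩
  · have he : (2.7182818283 : ℝ) < Real.exp 1 := Real.exp_one_gt_d9
    have h1 : Λ * (161 / 50 * b) + Λ * (509 / 500 - 161 / 50 * b) = 509 / 500 * Λ := by ring
    rw [h1, hΛ, ← mul_div_assoc, div_le_iff₀ (by positivity)]
    nlinarith [mul_pos (Real.exp_pos 1) (Real.exp_pos 1)]
  · intro u s hs1 hs2
    set r := Real.exp u with hr
    have hr0 : 0 < r := Real.exp_pos u
    set x := r * b / 4 with hx
    have hx0 : 0 < x := by positivity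
    have hcore := certHigh_core hb0.le hb1 hx0 hs1 hs2
    -- rewrite the left-hand side in the normalised variables
    have hpre : (8 * Real.pi ^ 2 / 3) * ((4 * Real.pi * T) ^ 2)⁻¹ = 1 / (6 * T ^ 2) := by
      have hπ : Real.pi ≠ 0 := Real.pi_ne_zero
      field_simp
      ring
    have h4 : Real.exp (4 * u) = r ^ 4 := by rw [hr, ← Real.exp_nat_mul]; norm_num
    have h2 : Real.exp (2 * u) = r ^ 2 := by rw [hr, ← Real.exp_nat_mul]; norm_num
    have hTb : T = 2 / b ^ 2 := by rw [hb2]; field_simp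
    have harg : -(r ^ 2 - 2 * r * s + 1) / (4 * T) =
        (2 - 2 * x ^ 2) + b * x * s + (-(b ^ 2 / 8) + -2) := by
      rw [hTb, hx]; field_simp; ring
    have hexp : Real.exp (-(r ^ 2 - 2 * r * s + 1) / (4 * T)) =
        Real.exp (2 - 2 * x ^ 2) * Real.exp (b * x * s) * (Real.exp (-(b ^ 2 / 8)) * (Real.exp 1 ^ 2)⁻¹) := by
      rw [harg, Real.exp_add, Real.exp_add]
      congr 1
      rw [Real.exp_add, ← Real.exp_nat_mul, ← Real.exp_neg]
      norm_num
    have hcoef : 1 / (6 * T ^ 2) * r ^ 4 = 32 / 3 * (x ^ 2) ^ 2 := by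
      rw [hTb, hx]; field_simp; ring
    have hsmall : Real.exp (-(b ^ 2 / 8)) ≤ 1 := by
      rw [Real.exp_le_one_iff]; nlinarith
    -- the height Gaussian of the atom
    have hσ : u - -Real.log (b / 4) = Real.log x := by
      rw [hx, hr, show Real.exp u * b / 4 = Real.exp u * (b / 4) by ring,
        Real.log_mul (Real.exp_pos u).ne' (by positivity), Real.log_exp]
      ring
    have hE : Real.exp (-(u - -Real.log (b / 4)) ^ 2 / (4 * Real.log 2)) =
        Real.exp (-Real.log (x ^ 2) ^ 2 / (16 * Real.log 2)) := by
      rw [hσ, Real.log_pow]; congr 1; push_cast; ring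
    rw [hpre, h4, h2, hexp, hE]
    have hL : 0 ≤ Real.exp (2 - 2 * x ^ 2) * Real.exp (b * x * s) := by positivity
    calc 1 / (6 * T ^ 2) * r ^ 4 *
          (Real.exp (2 - 2 * x ^ 2) * Real.exp (b * x * s) * (Real.exp (-(b ^ 2 / 8)) * (Real.exp 1 ^ 2)⁻¹))
        = Λ * ((x ^ 2) ^ 2 * Real.exp (2 - 2 * x ^ 2) * Real.exp (b * x * s)) * Real.exp (-(b ^ 2 / 8)) := by
          rw [show 1 / (6 * T ^ 2) * r ^ 4 *
              (Real.exp (2 - 2 * x ^ 2) * Real.exp (b * x * s) * (Real.exp (-(b ^ 2 / 8)) * (Real.exp 1 ^ 2)⁻¹))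
              = (1 / (6 * T ^ 2) * r ^ 4) *
              (Real.exp (2 - 2 * x ^ 2) * Real.exp (b * x * s) * (Real.exp (-(b ^ 2 / 8)) * (Real.exp 1 ^ 2)⁻¹))
              by ring, hcoef, hΛ]
          field_simp
      _ ≤ Λ * ((x ^ 2) ^ 2 * Real.exp (2 - 2 * x ^ 2) * Real.exp (b * x * s)) * 1 := by
          gcongr
      _ ≤ Λ * ((509 / 500 - 161 / 50 * b) + 161 / 50 * b *
            (Real.exp (-Real.log (x ^ 2) ^ 2 / (16 * Real.log 2)) * zonal (Real.log 2) s)) := by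
          rw [mul_one]; exact mul_le_mul_of_nonneg_left hcore hΛ0.le
      _ = Λ * (161 / 50 * b) * (zonal (Real.log 2) s *
            Real.exp (-Real.log (x ^ 2) ^ 2 / (16 * Real.log 2))) + Λ * (509 / 500 - 161 / 50 * b) := by
          ring

end Summit.SmoothPoincare4.SmoothPoincare4.Theorems.CylinderEntropySliceIsolation

end
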